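import Literature.Combinatorics.SimpleGraph.HarmonicMorphismsPushforward
import HarnessLib

/-!
# Harmonic morphisms IV: `φ^* : Jac(G′) → Jac(G)` is injective (Baker–Norine 2009, Theorem 30)

Source (held, read at the page; statements VERBATIM). M. Baker, S. Norine, *Harmonic morphisms
and hyperelliptic graphs*, Int. Math. Res. Not. IMRN 2009, no. 15, 2914–2955 [BakerNorine2009]
(held text `paper:arxiv-0707.1309`, chunk p0012). «The injectivity of `φ^*` is much more subtle
(as one would expect, since the analogous statement for Riemann surfaces is false):
**Theorem 30.** Let `φ : G → G′` be a non-constant harmonic morphism. Then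
`φ^* : Jac(G′) → Jac(G)` is injective.»
Proof (followed step by step below): «For a function `f : V(G) → ℤ`, let `max(f) = max_x f(x)`,
let `min(f) = min_x f(x)`, and let `s(f) = max(f) − min(f)`. Let `M(f) = {x ∈ V(G) | f(x) =
max(f)}`, and let `m(f) = {x ∈ V(G) | f(x) = min(f)}`. It suffices to show that `D′ ∈ Prin(G′)`
for every `D′ ∈ Div(G′)` such that `φ^*(D′) ∈ Prin(G)`. Suppose […] `φ^*(D′) = div(f)` […]. Choose
such a `D′` for which `s(f)` is minimized, and subject to this condition such that `|M(f)|` is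
minimized. Let `D := φ^*(D′) = div(f)`. Clearly `s(f) ≠ 0`, as otherwise `D = 0`, and therefore
`D′ = 0 ∈ Prin(G′)` […]. Therefore there exists a vertex `x₀ ∈ M(f)` with a neighbor in
`V(G) ∖ M(f)`. For every `x ∈ M(f)`, one has `D(x) = div(f)(x) ≥ |{e = xy : y ∈ V(G) ∖ M(f)}|`.
It follows that `D(x) ≥ 0` for every `x ∈ M(f)`, and that `D(x₀) > 0`. Similarly, for every
`x ∈ m(f)` one has either `D(x) < 0`, or else `D(x) = 0` and all the neighbors of `x` belong to
`m(f)`. Let `X = φ⁻¹(φ(x₀)) ∩ m(f)`. Since `D(x₀) > 0`, we have `D′(φ(x₀)) > 0` as well, so […]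
`D(x) > 0` for every `x ∈ φ⁻¹(φ(x₀))` with `m_φ(x) > 0`. Therefore `X` consists entirely of
vertices `x ∈ φ⁻¹(φ(x₀))` with `m_φ(x) = 0` and `D(x) = 0`. But then all the neighbors of vertices
in `X` belong to `φ⁻¹(φ(x₀))`, and thus by the above must belong to `X`. Since `G` is connected, it
follows that `X` is empty […]. Let `χ : V(G′) → ℤ` be the characteristic function of `{φ(x₀)}`,
and let `D″ = D′ − div(χ)`. […] `φ^*(D″) = div(f − χ ∘ φ)`. Let `f⋆ = f − χ ∘ φ`. […] we have
`min(f) = min(f⋆)`, and clearly `max(f) ≥ max(f⋆)`. Therefore `s(f) ≥ s(f⋆)`. Moreover, either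
`s(f) > s(f⋆)` or `max(f) = max(f⋆)`. In the second case, we have `M(f⋆) ⊆ M(f) ∖ {x₀}`, and
thus `|M(f)| > |M(f⋆)|`. It follows that `D″` contradicts the choice of `D′`.»

## What is formalised (simple graphs, the setting of `HarmonicMorphisms`; `Prin = laplacianLattice`,
## `div(f) = Δ(f) = G.lapMatrix ℤ *ᵥ f`, `φ^* = divPullback`, `Jac = criticalGroup`)

* the notation of the proof: `fnMax`, `fnMin` (`max(f)`, `min(f)`), `maxLocus`, `minLocus`
  (`M(f)`, `m(f)`) and their basic API; the Laplacian at an extremum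
  (`card_filter_le_lapMatrix_mulVec_of_mem_maxLocus`, `lapMatrix_mulVec_nonpos_of_mem_minLocus`,
  `mem_minLocus_of_adj`);
* the descent step of the proof (`IsHarmonicMorphism.exists_smaller_counterexample`: from a
  counterexample `(D′, f)` to one with smaller `(s(f), |M(f)|)`, the pair packed into one natural
  number), and **Theorem 30** at the level of divisors:
  `φ^*(D′) ∈ Prin(G) ⟹ D′ ∈ Prin(G′)` (`mem_laplacianLattice_of_divPullback_mem`, for a surjective
  — i.e. non-constant, Lemma 11 — harmonic morphism of connected graphs with `|V(G′)| > 1`),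
  `φ^* D₁ ∼ φ^* D₂ ⟹ D₁ ∼ D₂`, and on Jacobians: `jacPullback` is injective.

Definitions with bodies (the proof's notation) and theorems; no `sorry`; no named facts.
-/

open Finset SimpleGraph Matrix
open Literature.Combinatorics.SimpleGraph.ChipFiring

namespace Literature.Combinatorics.SimpleGraph.BakerNorine

variable {V V' : Type*} [Fintype V] [Fintype V'] [DecidableEq V] [DecidableEq V']
variable {G : SimpleGraph V} [DecidableRel G.Adj] {G' : SimpleGraph V'} [DecidableRel G'.Adj]

/-! ### §1 `max(f)`, `min(f)`, `M(f)`, `m(f)` -/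

section Extrema

variable [Nonempty V]

/-- `max(f) = max_{x ∈ V(G)} f(x)`. [cite: BakerNorine2009, Theorem 30 (proof, notation)] -/
def fnMax (f : V → ℤ) : ℤ := univ.sup' univ_nonempty f

/-- `min(f) = min_{x ∈ V(G)} f(x)`. [cite: BakerNorine2009, Theorem 30 (proof, notation)] -/
def fnMin (f : V → ℤ) : ℤ := univ.inf' univ_nonempty f

/-- `M(f) = {x ∈ V(G) | f(x) = max(f)}`. [cite: BakerNorine2009, Theorem 30 (proof, notation)] -/
def maxLocus (f : V → ℤ) : Finset V := univ.filter fun x => f x = fnMax f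

/-- `m(f) = {x ∈ V(G) | f(x) = min(f)}`. [cite: BakerNorine2009, Theorem 30 (proof, notation)] -/
def minLocus (f : V → ℤ) : Finset V := univ.filter fun x => f x = fnMin f

omit [DecidableEq V] in
/-- `f(x) ≤ max(f)`. [cite: BakerNorine2009, Theorem 30 (proof, notation)] -/
theorem le_fnMax (f : V → ℤ) (x : V) : f x ≤ fnMax f := Finset.le_sup' f (mem_univ x)

omit [DecidableEq V] in
/-- `min(f) ≤ f(x)`. [cite: BakerNorine2009, Theorem 30 (proof, notation)] -/
theorem fnMin_le (f : V → ℤ) (x : V) : fnMin f ≤ f x := Finset.inf'_le f (mem_univ x)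

omit [DecidableEq V] in
/-- The maximum is attained. [cite: BakerNorine2009, Theorem 30 (proof, notation)] -/
theorem exists_eq_fnMax (f : V → ℤ) : ∃ x, f x = fnMax f := by
  obtain ⟨x, -, hx⟩ := Finset.exists_mem_eq_sup' univ_nonempty f
  exact ⟨x, hx.symm⟩

omit [DecidableEq V] in
/-- The minimum is attained. [cite: BakerNorine2009, Theorem 30 (proof, notation)] -/
theorem exists_eq_fnMin (f : V → ℤ) : ∃ x, f x = fnMin f := by
  obtain ⟨x, -, hx⟩ := Finset.exists_mem_eq_inf' univ_nonempty f
  exact ⟨x, hx.symm⟩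

omit [DecidableEq V] in
/-- `max(f) ≤ a` as soon as `f ≤ a`. [cite: BakerNorine2009, Theorem 30 (proof, notation)] -/
theorem fnMax_le {f : V → ℤ} {a : ℤ} (h : ∀ x, f x ≤ a) : fnMax f ≤ a :=
  Finset.sup'_le _ f fun x _ => h x

omit [DecidableEq V] in
/-- `b ≤ min(f)` as soon as `b ≤ f`. [cite: BakerNorine2009, Theorem 30 (proof, notation)] -/
theorem le_fnMin {f : V → ℤ} {b : ℤ} (h : ∀ x, b ≤ f x) : b ≤ fnMin f :=
  Finset.le_inf' _ f fun x _ => h x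

omit [DecidableEq V] in
/-- Membership in `M(f)`. [cite: BakerNorine2009, Theorem 30 (proof, notation)] -/
theorem mem_maxLocus {f : V → ℤ} {x : V} : x ∈ maxLocus f ↔ f x = fnMax f := by
  simp [maxLocus]

omit [DecidableEq V] in
/-- Membership in `m(f)`. [cite: BakerNorine2009, Theorem 30 (proof, notation)] -/
theorem mem_minLocus {f : V → ℤ} {x : V} : x ∈ minLocus f ↔ f x = fnMin f := by
  simp [minLocus]

omit [Nonempty V] in
/-- `Δ(f)(x) = Σ_{u ∼ x} (f(x) − f(u))`. [cite: BakerNorine2009, §1.3 («`div(f) = Σ_x Σ_{e=xy}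
(f(x) − f(y))(x)`»)] -/
theorem lapMatrix_mulVec_eq_sum_sub (f : V → ℤ) (x : V) :
    (G.lapMatrix ℤ *ᵥ f) x = ∑ u ∈ G.neighborFinset x, (f x - f u) := by
  rw [lapMatrix_mulVec_apply, Finset.sum_sub_distrib, Finset.sum_const, card_neighborFinset_eq_degree,
    nsmul_eq_mul]

/-- «For every `x ∈ M(f)`, one has `D(x) = div(f)(x) ≥ |{e = xy : y ∈ V(G) ∖ M(f)}|`» (so
`D(x) ≥ 0` on `M(f)`). [cite: BakerNorine2009, Theorem 30 (proof)] -/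
theorem card_filter_le_lapMatrix_mulVec_of_mem_maxLocus (f : V → ℤ) {x : V}
    (hx : x ∈ maxLocus f) :
    (#{u ∈ G.neighborFinset x | u ∉ maxLocus f} : ℤ) ≤ (G.lapMatrix ℤ *ᵥ f) x := by
  rw [lapMatrix_mulVec_eq_sum_sub, Finset.natCast_card_filter]
  refine Finset.sum_le_sum fun u _ => ?_
  rw [mem_maxLocus] at hx
  have hu := le_fnMax f u
  by_cases h : u ∈ maxLocus f
  · rw [if_neg (not_not.2 h)]
    omega
  · rw [if_pos h]
    rw [mem_maxLocus] at h
    omega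

/-- «for every `x ∈ m(f)` one has either `D(x) < 0`, or else `D(x) = 0`» — `D(x) ≤ 0` on `m(f)`.
[cite: BakerNorine2009, Theorem 30 (proof)] -/
theorem lapMatrix_mulVec_nonpos_of_mem_minLocus (f : V → ℤ) {x : V} (hx : x ∈ minLocus f) :
    (G.lapMatrix ℤ *ᵥ f) x ≤ 0 := by
  rw [lapMatrix_mulVec_eq_sum_sub]
  refine Finset.sum_nonpos fun u _ => ?_
  rw [mem_minLocus] at hx
  have hu := fnMin_le f u
  omega

/-- «… or else `D(x) = 0` and all the neighbors of `x` belong to `m(f)`».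
[cite: BakerNorine2009, Theorem 30 (proof)] -/
theorem mem_minLocus_of_adj (f : V → ℤ) {x u : V} (hx : x ∈ minLocus f)
    (h0 : (G.lapMatrix ℤ *ᵥ f) x = 0) (hu : G.Adj x u) : u ∈ minLocus f := by
  rw [lapMatrix_mulVec_eq_sum_sub] at h0
  rw [mem_minLocus] at hx ⊢
  have hnn : ∀ w ∈ G.neighborFinset x, f x - f w ≤ 0 := fun w _ => by
    have := fnMin_le f w; omega
  have := (Finset.sum_eq_zero_iff_of_nonpos hnn).1 h0 u ((mem_neighborFinset _ _ _).2 hu)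
  have := fnMin_le f u
  omega

end Extrema

/-! ### §2 The descent step and Theorem 30 -/

section Injective

variable {φ : V → V'} (hφ : IsHarmonicMorphism G G' φ)
include hφ

omit [DecidableEq V] in
/-- `m_φ(x) = 0` forces every edge at `x` to be vertical («all the neighbors of vertices in `X`
belong to `φ⁻¹(φ(x₀))`»). [cite: BakerNorine2009, Theorem 30 (proof); Lemma 11 (proof)] -/
theorem IsHarmonicMorphism.apply_eq_of_horizMult_eq_zero {x u : V} (h0 : horizMult G G' φ x = 0)
    (hu : G.Adj x u) : φ u = φ x := by
  rcases hφ.adj_or_eq hu with h | h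
  · exfalso
    have h1 := hφ.horizMult_eq h
    rw [h0] at h1
    have : u ∈ ({w ∈ G.neighborFinset x | φ w = φ u} : Finset V) :=
      mem_filter.2 ⟨(mem_neighborFinset _ _ _).2 hu, rfl⟩
    rw [Finset.card_eq_zero.1 h1.symm] at this
    exact Finset.notMem_empty _ this
  · exact h.symm

/-- **The descent step of Theorem 30**: a counterexample `(D′, f)` — `D′ ∉ Prin(G′)`,
`φ^*(D′) = div(f)` — yields a counterexample `(D″, f⋆) = (D′ − div(χ_{φ(x₀)}), f − χ ∘ φ)` with
`(s(f⋆), |M(f⋆)|) < (s(f), |M(f)|)` lexicographically (the pair packed as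
`s · (|V| + 1) + |M|`). [cite: BakerNorine2009, Theorem 30 (proof)] -/
theorem IsHarmonicMorphism.exists_smaller_counterexample [Nontrivial V'] (hG : G.Connected)
    (hG' : G'.Connected) (hφs : Function.Surjective φ) {D' : V' → ℤ} {f : V → ℤ}
    (hD' : D' ∉ laplacianLattice G') (hf : divPullback G G' φ D' = G.lapMatrix ℤ *ᵥ f) :
    haveI : Nonempty V := hG.nonempty
    ∃ (D'' : V' → ℤ) (f' : V → ℤ), D'' ∉ laplacianLattice G' ∧
      divPullback G G' φ D'' = G.lapMatrix ℤ *ᵥ f' ∧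
      (fnMax f' - fnMin f').toNat * (Fintype.card V + 1) + #(maxLocus f') <
        (fnMax f - fnMin f).toNat * (Fintype.card V + 1) + #(maxLocus f) := by
  haveI : Nonempty V := hG.nonempty
  obtain ⟨y₀⟩ : Nonempty V' := ⟨φ (Classical.arbitrary V)⟩
  -- (i) `s(f) ≠ 0`: otherwise `D = 0`, so `deg(φ) D′ = φ_*φ^* D′ = 0` and `D′ = 0 ∈ Prin(G′)`
  have hs : fnMin f < fnMax f := by
    rcases (le_trans (fnMin_le f (Classical.arbitrary V)) (le_fnMax f _)).lt_or_eq with h | h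
    · exact h
    · exfalso
      have hconst : ∀ v w, f v = f w := fun v w => by
        have := le_fnMax f v; have := fnMin_le f v; have := le_fnMax f w; have := fnMin_le f w
        omega
      have hfc : f = f (Classical.arbitrary V) • fun _ : V => (1 : ℤ) := by
        funext v
        simp [hconst v (Classical.arbitrary V)]
      have hD0 : divPullback G G' φ D' = 0 := by
        rw [hf, hfc, Matrix.mulVec_smul, SimpleGraph.lapMatrix_mulVec_const_eq_zero, smul_zero]
      have hdeg := hφ.divPushforward_divPullback hG' y₀ D'
      rw [hD0, divPushforward_zero] at hdeg
      have hpos : 0 < harmonicDegree G G' φ y₀ :=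
        (hφ.harmonicDegree_pos_iff_surjective hG hG' y₀).2 hφs
      have : D' = 0 := by
        funext y
        have := congrFun hdeg y
        rw [Pi.zero_apply, Pi.smul_apply, smul_eq_mul, eq_comm, mul_eq_zero] at this
        rcases this with h1 | h1
        · exfalso
          exact hpos.ne' (by exact_mod_cast h1)
        · exact h1
      exact hD' (this ▸ zero_mem _)
  -- (ii) a maximum `x₀` with a neighbour outside `M(f)`
  obtain ⟨x₀, hx₀, u₀, hu₀, hx₀u₀⟩ : ∃ x₀ ∈ maxLocus f, ∃ u₀ ∉ maxLocus f, G.Adj x₀ u₀ := by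
    obtain ⟨a, ha⟩ := exists_eq_fnMax f
    obtain ⟨b, hb⟩ := exists_eq_fnMin f
    have haM : a ∈ (maxLocus f : Set V) := by rw [Finset.mem_coe, mem_maxLocus]; exact ha
    have hbM : b ∉ (maxLocus f : Set V) := by
      rw [Finset.mem_coe, mem_maxLocus, hb]; exact hs.ne
    obtain ⟨p⟩ := hG.preconnected a b
    obtain ⟨d, -, hd1, hd2⟩ := p.exists_boundary_dart _ haM hbM
    exact ⟨d.fst, hd1, d.snd, hd2, d.adj⟩
  -- (iii) `D(x₀) > 0`, hence (v) `D′(φ(x₀)) > 0`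
  have hDx₀ : 0 < (G.lapMatrix ℤ *ᵥ f) x₀ := by
    refine lt_of_lt_of_le ?_ (card_filter_le_lapMatrix_mulVec_of_mem_maxLocus f hx₀)
    exact_mod_cast Finset.card_pos.2 ⟨u₀, mem_filter.2 ⟨(mem_neighborFinset _ _ _).2 hx₀u₀, hu₀⟩⟩
  have hD'pos : 0 < D' (φ x₀) := by
    have h := congrFun hf x₀
    rw [divPullback_apply] at h
    rw [← h] at hDx₀
    by_contra hle
    push Not at hle
    have := mul_nonpos_iff.2 (Or.inl ⟨Int.natCast_nonneg (horizMult G G' φ x₀), hle⟩)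
    omega
  -- (vi) `X = φ⁻¹(φ(x₀)) ∩ m(f)` is empty
  have hX : ∀ x, φ x = φ x₀ → x ∉ minLocus f := by
    intro x hx hxm
    let S : Set V := {z | φ z = φ x₀ ∧ z ∈ minLocus f}
    have hxS : x ∈ S := ⟨hx, hxm⟩
    have hx₀S : x₀ ∉ S := fun h => by
      have h1 := mem_minLocus.1 h.2
      have h2 := mem_maxLocus.1 hx₀
      omega
    obtain ⟨p⟩ := hG.preconnected x x₀
    obtain ⟨d, -, ⟨hd1, hd1'⟩, hd2⟩ := p.exists_boundary_dart S hxS hx₀S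
    -- at `z = d.fst ∈ X`: `0 ≤ D(z) ≤ 0`, so `D(z) = 0`, `m_φ(z) = 0`, neighbours in `m(f)`
    have hz := congrFun hf d.fst
    rw [divPullback_apply, hd1] at hz
    have hle : (G.lapMatrix ℤ *ᵥ f) d.fst ≤ 0 := lapMatrix_mulVec_nonpos_of_mem_minLocus f hd1'
    have hge : 0 ≤ (G.lapMatrix ℤ *ᵥ f) d.fst := by
      rw [← hz]
      exact mul_nonneg (Int.natCast_nonneg _) hD'pos.le
    have h0 : (G.lapMatrix ℤ *ᵥ f) d.fst = 0 := le_antisymm hle hge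
    have hm0 : horizMult G G' φ d.fst = 0 := by
      rw [h0, mul_eq_zero] at hz
      rcases hz with h | h
      · exact_mod_cast h
      · exact absurd h hD'pos.ne'
    exact hd2 ⟨(hφ.apply_eq_of_horizMult_eq_zero hm0 d.adj).trans hd1,
      mem_minLocus_of_adj f hd1' h0 d.adj⟩
  -- (vii) the new counterexample `D″ = D′ − Δ′(χ)`, `f⋆ = f − χ ∘ φ`, `χ = (φ(x₀))`
  set χ : V' → ℤ := Pi.single (φ x₀) 1 with hχ
  have hχφ : ∀ x, (χ ∘ φ) x = if φ x = φ x₀ then 1 else 0 := fun x => by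
    simp only [Function.comp_apply, hχ, Pi.single_apply]
  refine ⟨D' - G'.lapMatrix ℤ *ᵥ χ, f - χ ∘ φ, ?_, ?_, ?_⟩
  · intro hmem
    apply hD'
    have := add_mem hmem ((mem_laplacianLattice_iff G' _).2 ⟨χ, rfl⟩)
    rwa [sub_add_cancel] at this
  · rw [divPullback_sub, hφ.divPullback_lapMatrix_mulVec, hf, Matrix.mulVec_sub]
  · -- (viii) compare `(s, |M|)` for `f⋆ = f − χ ∘ φ` and `f`
    have hle' : ∀ x, (f - χ ∘ φ) x ≤ f x := fun x => by
      rw [Pi.sub_apply, hχφ]; split_ifs <;> omega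
    have hge' : ∀ x, f x - 1 ≤ (f - χ ∘ φ) x := fun x => by
      rw [Pi.sub_apply, hχφ]; split_ifs <;> omega
    -- `min(f⋆) = min(f)`
    have hmin : fnMin (f - χ ∘ φ) = fnMin f := by
      refine le_antisymm ?_ (le_fnMin fun x => ?_)
      · obtain ⟨b, hb⟩ := exists_eq_fnMin f
        have hbX : φ b ≠ φ x₀ := fun h => hX b h (mem_minLocus.2 hb)
        have : (f - χ ∘ φ) b = f b := by rw [Pi.sub_apply, hχφ, if_neg hbX, sub_zero]
        rw [← hb, ← this]
        exact fnMin_le _ b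
      · rw [Pi.sub_apply, hχφ]
        split_ifs with hx
        · have h1 : f x ≠ fnMin f := fun h => hX x hx (mem_minLocus.2 h)
          have h2 := fnMin_le f x
          omega
        · rw [sub_zero]; exact fnMin_le f x
    -- `max(f⋆) ≤ max(f)`
    have hmax : fnMax (f - χ ∘ φ) ≤ fnMax f := fnMax_le fun x => (hle' x).trans (le_fnMax f x)
    have hcardV : #(maxLocus (f - χ ∘ φ)) ≤ Fintype.card V := Finset.card_le_univ _
    have hs0 : 0 ≤ fnMax (f - χ ∘ φ) - fnMin (f - χ ∘ φ) :=
      sub_nonneg.2 ((fnMin_le _ (Classical.arbitrary V)).trans (le_fnMax _ _))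
    rcases hmax.lt_or_eq with hlt | heq
    · -- `s(f⋆) < s(f)`
      have h1 : (fnMax (f - χ ∘ φ) - fnMin (f - χ ∘ φ)).toNat + 1 ≤ (fnMax f - fnMin f).toNat := by
        rw [hmin]
        have : (fnMax (f - χ ∘ φ) - fnMin f).toNat + 1 = (fnMax (f - χ ∘ φ) - fnMin f + 1).toNat := by
          rw [hmin] at hs0
          omega
        rw [this]
        exact Int.toNat_le_toNat (by omega)
      calc (fnMax (f - χ ∘ φ) - fnMin (f - χ ∘ φ)).toNat * (Fintype.card V + 1) +
            #(maxLocus (f - χ ∘ φ))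
          < ((fnMax (f - χ ∘ φ) - fnMin (f - χ ∘ φ)).toNat + 1) * (Fintype.card V + 1) := by
            rw [add_mul, one_mul]; omega
        _ ≤ (fnMax f - fnMin f).toNat * (Fintype.card V + 1) := Nat.mul_le_mul_right _ h1
        _ ≤ _ := Nat.le_add_right _ _
    · -- `max(f⋆) = max(f)`: then `M(f⋆) ⊆ M(f) ∖ {x₀}`
      rw [heq, hmin]
      apply Nat.add_lt_add_left
      have hsub : maxLocus (f - χ ∘ φ) ⊆ (maxLocus f).erase x₀ := by
        intro x hx
        rw [mem_maxLocus, heq] at hx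
        have hfx : f x = fnMax f := le_antisymm (le_fnMax f x) (hx ▸ hle' x)
        refine Finset.mem_erase.2 ⟨?_, mem_maxLocus.2 hfx⟩
        rintro rfl
        rw [Pi.sub_apply, hχφ, if_pos rfl] at hx
        omega
      calc #(maxLocus (f - χ ∘ φ)) ≤ #((maxLocus f).erase x₀) := Finset.card_le_card hsub
        _ < #(maxLocus f) := Finset.card_erase_lt_of_mem hx₀

/-- **Theorem 30** (divisor form): for a non-constant (= surjective, Lemma 11) harmonic morphism
of connected graphs with `|V(G′)| > 1`, «`D′ ∈ Prin(G′)` for every `D′ ∈ Div(G′)` such that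
`φ^*(D′) ∈ Prin(G)`». [cite: BakerNorine2009, Theorem 30] -/
theorem IsHarmonicMorphism.mem_laplacianLattice_of_divPullback_mem [Nontrivial V']
    (hG : G.Connected) (hG' : G'.Connected) (hφs : Function.Surjective φ) {D' : V' → ℤ}
    (h : divPullback G G' φ D' ∈ laplacianLattice G) : D' ∈ laplacianLattice G' := by
  haveI : Nonempty V := hG.nonempty
  by_contra hD'
  -- «Choose such a `D′` for which `s(f)` is minimized, and subject to this condition such that
  -- `|M(f)|` is minimized»: minimise `s(f) · (|V| + 1) + |M(f)|` over all counterexamples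
  have hex : ∃ n : ℕ, ∃ (E' : V' → ℤ) (f : V → ℤ), E' ∉ laplacianLattice G' ∧
      divPullback G G' φ E' = G.lapMatrix ℤ *ᵥ f ∧
      (fnMax f - fnMin f).toNat * (Fintype.card V + 1) + #(maxLocus f) = n := by
    obtain ⟨f, hf⟩ := (mem_laplacianLattice_iff G _).1 h
    exact ⟨_, D', f, hD', hf.symm, rfl⟩
  classical
  obtain ⟨E', f, hE', hf, hn⟩ := Nat.find_spec hex
  obtain ⟨E'', f', hE'', hf', hlt⟩ := hφ.exists_smaller_counterexample hG hG' hφs hE' hf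
  rw [hn] at hlt
  exact Nat.find_min hex hlt ⟨E'', f', hE'', hf', rfl⟩

/-- **Theorem 30** on linear equivalence: `φ^* D₁ ∼ φ^* D₂ ⟹ D₁ ∼ D₂` (used in the proof of
Theorem 51: «Therefore, by Theorem 30, we have `(x) ∼ (y)`»).
[cite: BakerNorine2009, Theorem 30] -/
theorem IsHarmonicMorphism.linEquiv_of_linEquiv_divPullback [Nontrivial V'] (hG : G.Connected)
    (hG' : G'.Connected) (hφs : Function.Surjective φ) {D₁ D₂ : V' → ℤ}
    (h : LinEquiv G (divPullback G G' φ D₁) (divPullback G G' φ D₂)) : LinEquiv G' D₁ D₂ := by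
  rw [linEquiv_iff] at h ⊢
  rw [← divPullback_sub] at h
  exact hφ.mem_laplacianLattice_of_divPullback_mem hG hG' hφs h

/-- **Theorem 30**: «Let `φ : G → G′` be a non-constant harmonic morphism. Then
`φ^* : Jac(G′) → Jac(G)` is injective.» (connected graphs; non-constant = surjective, Lemma 11).
[cite: BakerNorine2009, Theorem 30] -/
theorem IsHarmonicMorphism.jacPullback_injective (hG : G.Connected) (hG' : G'.Connected)
    (hφs : Function.Surjective φ) : Function.Injective (hφ.jacPullback hG') := by
  refine (injective_iff_map_eq_zero _).2 fun c hc => ?_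
  obtain ⟨D', rfl⟩ := QuotientAddGroup.mk_surjective c
  rw [QuotientAddGroup.eq_zero_iff, AddSubgroup.mem_addSubgroupOf]
  rw [hφ.jacPullback_mk, QuotientAddGroup.eq_zero_iff, AddSubgroup.mem_addSubgroupOf,
    hφ.coe_divPullbackHom₀] at hc
  rcases subsingleton_or_nontrivial V' with hV' | hV'
  · -- one vertex: `Div⁰(G′) = 0`
    obtain ⟨y₀⟩ := hG'.nonempty
    have hD0 : (D' : V' → ℤ) = 0 := by
      funext y
      have hs := (mem_zeroSumLattice_iff _).1 D'.2
      rw [Fintype.sum_subsingleton _ y] at hs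
      exact hs
    rw [hD0]
    exact zero_mem _
  · exact hφ.mem_laplacianLattice_of_divPullback_mem hG hG' hφs hc

/-- **Theorem 30** for a non-constant harmonic morphism (Lemma 11 supplies surjectivity).
[cite: BakerNorine2009, Theorem 30 (with Lemma 11)] -/
theorem IsHarmonicMorphism.jacPullback_injective_of_ne (hG : G.Connected) (hG' : G'.Connected)
    {x₁ x₂ : V} (hne : φ x₁ ≠ φ x₂) : Function.Injective (hφ.jacPullback hG') :=
  hφ.jacPullback_injective hG hG' (hφ.surjective_of_ne hG hG' hne)

end Injective

end Literature.Combinatorics.SimpleGraph.BakerNorine
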